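import Summits.SmoothPoincare4.SmoothPoincare4.Theorems.CongruenceShadowsNormalFormStablyTrivialLuftStubGateAscent
import Summits.SmoothPoincare4.SmoothPoincare4.Theorems.CongruenceShadowsNormalFormStablyTrivialLuftStubFreePadding
import Summits.SmoothPoincare4.SmoothPoincare4.Theorems.CongruenceShadowsNormalFormStablyTrivialLuftStubMovesGoeritz
import Summits.SmoothPoincare4.SmoothPoincare4.Theorems.CongruenceShadowsNormalFormStablyTrivialLuftStubEraseStabilize
import Summits.SmoothPoincare4.SmoothPoincare4.Theorems.CongruenceShadowsNormalFormStablyTrivialLuftStubPaddingTransfer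
import Literature.Topology.FourManifolds.SurfaceGroupNielsenTheorem

/-!
# Line `luft-twist-reduction` for crux `NormalFormStablyTrivial` (stmt-SmoothPoincare4-14591) —
# SKELETON v6 (lead c4): `stub_nielsenLift` PROVED (Nielsen's theorem landed); the only stub is `stub_twistGate`

Crux `NormalFormStablyTrivial` (stmt-SmoothPoincare4-14591), line `luft-twist-reduction`.  The Luft
reduction (lead c3: `stub_gateAscent` p128901, `stub_freePadding` p129851, `stub_movesGoeritz`
p131289, `stub_eraseStabilize` p132237, `stub_paddingTransfer` p132501, `…LuftReduction` p132691)
reduced the crux to Nielsen's lifting theorem and the twist gate.  Nielsen's theorem — the named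
fact `nielsen_surfaceGroup_mulEquiv_lift` — is now a THEOREM of the tree (lead c4, cycle 2:
`nielsen_surfaceGroup_mulEquiv_lift_holds`, `Literature/Topology/FourManifolds/SurfaceGroupNielsenTheorem.lean`
p139631; Zieschang's algebraic proof, LNM 835 Thm. 5.6.1, in five pillars — block lemma A3
p135442, planar counting B p136299, degree C1 p135182, Zieschang–Nielsen C2 p137313, and the CORE
(homotopic shortening of binary products recast as "no double point on the closed path of a
potential-minimal configuration", dispatcher `noDoublePoints_holds` over eleven cut cases) — 58
Literature files).  Hence `stub_nielsenLift` below is a one-line theorem and the skeleton closes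
the crux modulo the single registered stub `stub_twistGate` — which IS the crux
(`normalFormStablyTrivial_iff_twistGate_of_nielsen` + Nielsen: `Theorems/…LuftEquivalence.lean`).
-/

-- the prescribed namespace `Summit.<P>.<Sub>.…` duplicates `SmoothPoincare4` (P = Sub)
set_option linter.dupNamespace false

noncomputable section

namespace Summit.SmoothPoincare4.SmoothPoincare4.Theorems.NormalFormStablyTrivial.Luft

open Literature.Topology.FourManifolds
open Summit.SmoothPoincare4.SmoothPoincare4.Theses.CongruenceShadows (NormalFormStablyTrivial)
/-! ## The registered stubs (`sorry` only here) -/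

/-- FORMER STUB, now a theorem of the tree: Nielsen's lifting theorem
(`nielsen_surfaceGroup_mulEquiv_lift_holds`, Zieschang's algebraic proof, LNM 835 Thm. 5.6.1). -/
theorem stub_nielsenLift : nielsen_surfaceGroup_mulEquiv_lift :=
  nielsen_surfaceGroup_mulEquiv_lift_holds

/-- STUB (HARDEST, open — the residual crux, held by the lead): the twist gate. -/
theorem stub_twistGate : TwistGate := by
  sorry

/-! ## The composition (landed stubs by name; = `normalFormStablyTrivial_of_nielsen_of_twistGate` of
`…LuftReduction.lean`, spelled out so that this workfile does not depend on the newest tree module) -/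

/-- The skeleton closes the crux modulo the registered stubs. -/
theorem normalFormStablyTrivial_skeleton : NormalFormStablyTrivial :=
  NormalFormStablyTrivial_of stub_nielsenLift (stub_gateAscent stub_nielsenLift) stub_freePadding
    stub_movesGoeritz stub_eraseStabilize stub_paddingTransfer stub_twistGate

end Summit.SmoothPoincare4.SmoothPoincare4.Theorems.NormalFormStablyTrivial.Luft

end
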